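import Summits.FinalStateConjecture.FinalStateConjecture.Theorems.ZeroEnergyKerrOrBombStationaryLimitReductionKerrIsometryRigidityWave3EndTopology
import Summits.FinalStateConjecture.FinalStateConjecture.Theorems.SwallowTheDatumUniversalWitnessFamilyRegionOneHoleChart
import Literature.Geometry.Lorentzian.GaussianBeamPhase
import HarnessLib

/-!
# Route ZeroEnergyKerrOrBomb · crux `StationaryLimitReduction` (stmt-FinalStateConjecture-10021), line
# `symplectic-dual-of-the-bomb` — stub 1R `kerrIsometryRigidity`, wave 3: END MATCHING, the topological core

Helper file (`--supports stmt-FinalStateConjecture-10021`; registered helper `far_of_explicitField`) of the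
lead's wave-3 stub-worker for `stub_kerrIsometryRigidity` (lead prover-line-stmt-FinalStateConjecture-10021-a2-0,
2026-08-16). Third of the files proving the end-matching obligation F0 (`KerrEndMatching` of
`…KerrIsometryRigidityWave3Facts`); fact-free. It continues `…Wave3ChartMap` (p125496: `kerrChartMap_clauses`,
`chartDoc`) and `…Wave3EndTopology` (`chartInv`, the pulled-back chart-time lines).

* §5 `far_of_explicitField` (registered): END MATCHING from an explicit continuous extension `Yv` of the
  pulled-back Killing field `Ψ^*T` with constant time component, annihilating `r` on the exterior, with
  non-negative norm on `{r = r₊}` (and on the exterior if the time component vanishes) — the abstract Kerr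
  isometry sends Kerr's spatial infinity into the far cylinder of the adapted chart. The two Killing-algebra
  facts supply such a `Yv` (`α ∂_{t*} + β ∂_φ`, resp. `α ∂_t + (0, W₀ y)`) in the next file.

References: P. T. Chruściel, J. L. Costa, arXiv:0806.0016, Thm. 1.3, §2.2; S. Alexakis, A. D. Ionescu,
S. Klainerman, arXiv:0904.0982, §1.1; B. O'Neill, *Semi-Riemannian Geometry* (1983), Ch. 1.
-/

set_option linter.dupNamespace false

noncomputable section

open scoped Manifold ContDiff Topology
open Set Filter Function

namespace Summit.FinalStateConjecture.FinalStateConjecture.Theorems.SymplecticDualOfTheBomb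

open Literature.Geometry.Lorentzian Literature.Geometry.Manifold

/-! ## §5 End matching from an explicit form of the pulled-back Killing field -/

section EndMatching

open Summit.FinalStateConjecture.FinalStateConjecture.Theorems.OneLockedExplosion

variable {𝓑 : StationaryAFBlackHole.{0}}

/-- In an asymptotically Cartesian adapted chart, `A.bilin u (e₀, e₀) ≤ −1/2` far out (clause (1) with
`ε = 1/2`, `η(e₀, e₀) = −1`, `‖e₀‖ = 1`). Alexakis–Ionescu–Klainerman arXiv:0904.0982, §1.1. [folklore] -/
theorem adaptedChart_bilin_basisVector_le (A : 𝓑.AdaptedChart) (hA : ChartIsAsymptoticallyCartesian A) :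
    ∃ R₀ : ℝ, ∀ u : A.domain, R₀ ≤ A.radius u.1 →
      A.bilin u.1 (E4.basisVector 0) (E4.basisVector 0) ≤ -(1 / 2) := by
  obtain ⟨R₀, hR₀⟩ := hA.1 (1 / 2) one_half_pos
  refine ⟨R₀, fun u hu ↦ ?_⟩
  have h : ‖A.bilin u.1 (E4.basisVector 0) (E4.basisVector 0) -
      Minkowski.bilin (E4.basisVector 0) (E4.basisVector 0)‖ ≤
      ‖A.bilin u.1 - Minkowski.bilin‖ * ‖(E4.basisVector 0 : E4)‖ * ‖(E4.basisVector 0 : E4)‖ :=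
    (A.bilin u.1 - Minkowski.bilin).le_opNorm₂ (E4.basisVector 0) (E4.basisVector 0)
  have h1 : ‖(E4.basisVector 0 : E4)‖ = 1 := by
    rw [E4.basisVector, PiLp.norm_single, norm_one]
  rw [Real.norm_eq_abs, h1, mul_one, mul_one, Minkowski.bilin_basisVector_zero] at h
  linarith [(abs_le.1 (h.trans (hR₀ u hu))).2]

/-- `infDist` to a chart-time-translation invariant set is chart-time-translation invariant. [folklore] -/
theorem infDist_add_smul_basisVector {T : Set E4} (hT : ∀ u ∈ T, ∀ s : ℝ, u + s • E4.basisVector 0 ∈ T)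
    (u : E4) (s : ℝ) : Metric.infDist (u + s • E4.basisVector 0) T = Metric.infDist u T := by
  have hΦ : Isometry (fun v : E4 ↦ v + s • E4.basisVector 0) := isometry_add_right _
  have himg : (fun v : E4 ↦ v + s • E4.basisVector 0) '' T = T := by
    ext v
    constructor
    · rintro ⟨w, hw, rfl⟩
      exact hT w hw s
    · intro hv
      refine ⟨v + (-s) • E4.basisVector 0, hT v hv (-s), ?_⟩
      simp only
      rw [add_assoc, ← add_smul, neg_add_cancel, zero_smul, add_zero]
  conv_lhs => rw [← himg]
  exact Metric.infDist_image hΦ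

/-- **End matching from an explicit form of `Y = Ψ^*T`** (the topological core of obligation F0). Let
`𝓑` be a stationary black hole with non-empty horizon charted by the asymptotically Cartesian, asymptotically
Schwarzschildean adapted chart `A`, `Ψ` an injective isometric immersion of the sub-extremal Kerr exterior onto
`𝓑.doc`, and suppose the pulled-back Killing field `Y = Ψ^*T` extends to a continuous field `Yv` on `E4` with
constant time component `α`, annihilating the Kerr–Schild radius on the exterior, with `g_{M,a}(Yv, Yv) ≥ 0` on
the horizon `{r = r₊}`, and `g_{M,a}(Yv, Yv) ≥ 0` on the exterior if `α = 0`. Then `A⁻¹ ∘ Ψ` sends Kerr's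
spatial infinity into the far cylinder of `A`. Proof: `Θ₀ = A⁻¹ ∘ Ψ` is a homeomorphism of the exterior onto
the chart preimage `P` of the d.o.c. (`kerrChartMap_clauses`, `kerrCharted_isOpenEmbedding`); `P` is chart-time
invariant and contains the far cylinder, `Pᶜ ≠ ∅`; the chart-time lines pull back to integral curves of `Y`
along which `r` is constant and the Kerr–Schild time is affine of slope `α` (inverse function theorem, §3);
the `Θ₀`-preimage of the compact middle region `{‖y‖ ≤ R', dist(·, Pᶜ) ≥ 1/2, t = 0}` of `P` has bounded
radius, so (time normalisation) `Θ₀ {r > R''}` misses the middle region and, being connected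
(`Kerr.isConnected_region`), lies in the far cylinder `{‖y‖ > R'}` or in the collar `{dist(·, Pᶜ) < 1/2}` of
`∂P`; the collar case is impossible: the `Θ₀`-preimages of the far leaf points `(0, n w₀)`, time-normalised,
have bounded radius and accumulate at a point with `r = r₊`, where `g(Yv, Yv) ≥ 0`, while along the
sequence `g(Y, Y) = g_𝓑(T, T) = A.bilin (e₀, e₀) ≤ −1/2` (`ChartIsAsymptoticallyCartesian` (1)).
Chruściel–Costa arXiv:0806.0016, Thm. 1.3 and §2.2 (the unwritten "ends go to ends" step). [folklore] -/
theorem far_of_explicitField : ∀ [Kerr.Facts] (𝓑 : StationaryAFBlackHole.{0}) (A : 𝓑.AdaptedChart) (M a : ℝ) (Ψ : Kerr.exterior M a → 𝓑.carrier) (Yv : E4 → E4) (α : ℝ), 𝓑.horizon.Nonempty → 𝓑.horizon ⊆ Set.range A.toFun → ChartIsAsymptoticallyCartesian A → ChartIsAsymptoticallySchwarzschildean' A → Kerr.IsSubextremal M a → Function.Injective Ψ → Set.range Ψ = 𝓑.doc → PseudoRiemannianMetric.IsIsometricImmersion (Kerr.smoothMetric M a (Kerr.rPlus M a)).toPseudoRiemannianMetric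 𝓑.metric.toPseudoRiemannianMetric Ψ → (∀ x : Kerr.exterior M a, (VectorField.mpullback 𝓘(ℝ, E4) (𝓡 4) Ψ 𝓑.killing x : E4) = Yv x.1) → Continuous Yv → (∀ x, Yv x 0 = α) → (∀ x ∈ (Kerr.exterior M a : Set E4), fderiv ℝ (Kerr.radius a) x (Yv x) = 0) → (∀ x : E4, Kerr.radius a x = Kerr.rPlus M a → 0 ≤ Kerr.bilin M a x (Yv x) (Yv x)) → (α = 0 → ∀ x ∈ (Kerr.exterior M a : Set E4), 0 ≤ Kerr.bilin M a x (Yv x) (Yv x)) → ∀ R₁ : ℝ, ∃ R : ℝ, ∀ x : Kerr.exterior M a, R ≤ Kerr.radius a x.1 → R₁ ≤ A.radius (chartPreimage A (Ψ x)) := by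
  intro _ 𝓑 A M a Ψ Yv α hne hhor hcart hschw hMa hΨi hΨr hΨiso hYv hYc hα hYr hYhor hY0 R₁
  set S : Set E4 := (Kerr.exterior M a : Set E4) with hS_def
  set Θ : E4 → E4 := kerrChartMap A Ψ with hΘ_def
  have hA : ∀ x : A.domain, Function.Injective (mfderiv 𝓘(ℝ, E4) (𝓡 4) A.toFun x) := hcart.2.2.1
  obtain ⟨hΘs, hΘinj, hΘmaps, hΘiso, hΘimg, hΘA, hΘY⟩ := kerrChartMap_clauses 𝓑 A M a Ψ hA hΨi hΨr hΨiso
  have hSo : IsOpen S := (Kerr.exterior M a).isOpen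
  have hB₂ : ∀ x ∈ S, ∀ v : E4, (∀ w, Kerr.bilin M a x v w = 0) → v = 0 := fun x hx v hv ↦
    Kerr.bilin_nondegenerate M a (Kerr.radius_pos_of_mem_region hx) v hv
  have hYv' : ∀ x ∈ S, fderiv ℝ Θ x (Yv x) = E4.basisVector 0 := fun x hx ↦ by
    rw [← hYv ⟨x, hx⟩]; exact hΘY ⟨x, hx⟩
  -- `P = Θ '' S` and its chart-time invariance
  have hPinv : ∀ u ∈ Θ '' S, ∀ s : ℝ, u + s • E4.basisVector 0 ∈ Θ '' S := by
    intro u hu s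
    rw [hΘimg] at hu ⊢
    exact add_smul_basisVector_mem_chartDoc A hu s
  have hPcinv : ∀ u ∈ (Θ '' S)ᶜ, ∀ s : ℝ, u + s • E4.basisVector 0 ∈ (Θ '' S)ᶜ := by
    intro u hu s h
    have h' := hPinv _ h (-s)
    rw [add_assoc, ← add_smul, add_neg_cancel, zero_smul, add_zero] at h'
    exact hu h'
  -- constants
  obtain ⟨C, hC⟩ := A.exists_abs_radius_sub_spatialNorm_le
  obtain ⟨R₀P, hR₀P⟩ := mem_chartDoc_of_le_spatialNorm A hschw
  obtain ⟨R₀c, hR₀c⟩ := adaptedChart_bilin_basisVector_le A hcart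
  obtain ⟨v₀, hv₀⟩ := compl_chartDoc_nonempty A hne hhor
  have hv₀' : v₀ ∈ (Θ '' S)ᶜ := by rwa [hΘimg]
  have hrp : 0 < Kerr.rPlus M a := by
    have h1 : M ≤ Kerr.rPlus M a := by
      unfold Kerr.rPlus; linarith [Real.sqrt_nonneg (M ^ 2 - a ^ 2)]
    exact hMa.pos.trans_le h1
  have hfarP : ∀ u : E4, R₀P ≤ E4.spatialNorm u → u ∈ Θ '' S := fun u hu ↦ by
    rw [hΘimg]; exact hR₀P u hu
  have hradA : ∀ u : E4, E4.spatialNorm u - C ≤ A.radius u := fun u ↦ by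
    linarith [(abs_le.1 (hC u)).1]
  -- the norm `Q = g(Yv, Yv)` and its chart expression on `S`
  set Q : E4 → ℝ := fun x ↦ Kerr.bilin M a x (Yv x) (Yv x) with hQ_def
  have keyG : ∀ p q : 𝓑.carrier, p = q → ∀ v w : E4, 𝓑.metric.val p v w = 𝓑.metric.val q v w := by
    rintro p q rfl v w; rfl
  have keyT : ∀ p q : 𝓑.carrier, p = q → (𝓑.killing p : E4) = 𝓑.killing q := by
    rintro p q rfl; rfl
  have hQchart : ∀ x (hx : x ∈ S), Q x = A.bilin (Θ x) (E4.basisVector 0) (E4.basisVector 0) := by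
    intro x hx
    set Y := VectorField.mpullback 𝓘(ℝ, E4) (𝓡 4) Ψ 𝓑.killing with hY
    -- `g_{M,a}(Y, Y) = g_𝓑(T, T)(Ψ x)`
    have h1 := DFunLike.congr_fun (DFunLike.congr_fun (hΨiso.2 ⟨x, hx⟩) (Y ⟨x, hx⟩)) (Y ⟨x, hx⟩)
    have h1' : 𝓑.metric.val (Ψ ⟨x, hx⟩) (mfderiv 𝓘(ℝ, E4) (𝓡 4) Ψ ⟨x, hx⟩ (Y ⟨x, hx⟩))
        (mfderiv 𝓘(ℝ, E4) (𝓡 4) Ψ ⟨x, hx⟩ (Y ⟨x, hx⟩)) =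
        (Kerr.smoothMetric M a (Kerr.rPlus M a)).val ⟨x, hx⟩ (Y ⟨x, hx⟩) (Y ⟨x, hx⟩) := h1
    have e : mfderiv 𝓘(ℝ, E4) (𝓡 4) Ψ (⟨x, hx⟩ : Kerr.exterior M a) (Y ⟨x, hx⟩) =
        𝓑.killing (Ψ ⟨x, hx⟩) :=
      PseudoRiemannianMetric.mfderiv_mpullback_apply (I := 𝓡 4) (I' := 𝓘(ℝ, E4)) (M := 𝓑.carrier)
        (N := Kerr.region a (Kerr.rPlus M a)) (Φ := Ψ) hΨiso.injective_mfderiv rfl 𝓑.killing ⟨x, hx⟩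
    rw [e, Kerr.smoothMetric_val] at h1'
    -- `g_𝓑(T, T)(Ψ x) = A.bilin (Θ x) (e₀, e₀)`
    obtain ⟨hd, hAx⟩ := hΘA ⟨x, hx⟩
    have h2 : A.bilin (Θ x) (E4.basisVector 0) (E4.basisVector 0) =
        𝓑.metric.val (Ψ ⟨x, hx⟩) (𝓑.killing (Ψ ⟨x, hx⟩)) (𝓑.killing (Ψ ⟨x, hx⟩)) := by
      rw [A.bilin_eq ⟨Θ x, hd⟩]
      change 𝓑.metric.val (A.toFun ⟨Θ x, hd⟩) (mfderiv 𝓘(ℝ, E4) (𝓡 4) A.toFun ⟨Θ x, hd⟩ (E4.basisVector 0))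
        (mfderiv 𝓘(ℝ, E4) (𝓡 4) A.toFun ⟨Θ x, hd⟩ (E4.basisVector 0)) = _
      rw [A.mfderiv_toFun_basisVector ⟨Θ x, hd⟩, keyT _ _ hAx, keyG _ _ hAx]
    rw [h2, h1']
    change Kerr.bilin M a x (Yv x) (Yv x) = Kerr.bilin M a x (Y ⟨x, hx⟩ : E4) (Y ⟨x, hx⟩ : E4)
    rw [hYv ⟨x, hx⟩]
  have hQfar : ∀ x ∈ S, R₀c + C ≤ E4.spatialNorm (Θ x) → Q x ≤ -(1 / 2) := by
    intro x hx hfar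
    rw [hQchart x hx]
    exact hR₀c ⟨Θ x, hΘmaps hx⟩ (by linarith [hradA (Θ x)])
  -- the far radius `R'`
  set R' : ℝ := max (max (max (R₀P + 1) (R₀c + C)) (R₁ + C)) 0 with hR'_def
  have hR'1 : R₀P + 1 ≤ R' := le_trans (le_trans (le_max_left _ _) (le_max_left _ _)) (le_max_left _ _)
  have hR'2 : R₀c + C ≤ R' := le_trans (le_trans (le_max_right _ _) (le_max_left _ _)) (le_max_left _ _)
  have hR'3 : R₁ + C ≤ R' := le_trans (le_max_right _ _) (le_max_left _ _)
  have hR'0 : 0 ≤ R' := le_max_right _ _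
  -- the far leaf points `u_n = (0, (R' + 1 + n) w₀)`
  set w₀ : E3 := EuclideanSpace.single (0 : Fin 3) (1 : ℝ) with hw₀
  have hnw₀ : ‖w₀‖ = 1 := by rw [hw₀, PiLp.norm_single, norm_one]
  set uSeq : ℕ → E4 := fun n ↦ E4.ofTimeSpace 0 ((R' + 1 + n) • w₀) with huSeq
  have huN : ∀ n : ℕ, E4.spatialNorm (uSeq n) = R' + 1 + n := fun n ↦ by
    rw [huSeq]
    dsimp only
    rw [E4.spatialNorm_ofTimeSpace, norm_smul, hnw₀, mul_one, Real.norm_of_nonneg (by positivity)]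
  have hu0 : ∀ n : ℕ, uSeq n 0 = 0 := fun n ↦ E4.ofTimeSpace_apply_zero _ _
  have huP : ∀ n : ℕ, uSeq n ∈ Θ '' S := fun n ↦ hfarP _ (by rw [huN]; linarith)
  -- `α = 0` is contradictory
  by_cases hα0 : α = 0
  · exfalso
    obtain ⟨hxS, hxu⟩ := chartInv_spec (huP 0)
    have h1 := hQfar _ hxS (by rw [hxu, huN]; push_cast; linarith)
    have h2 := hY0 hα0 _ hxS
    change Kerr.bilin M a _ _ _ ≤ -(1 / 2) at h1
    linarith
  -- the middle region and the radius bound on its preimage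
  set Mid : Set E4 := {u | E4.spatialNorm u ≤ R' ∧ (1 / 2 : ℝ) ≤ Metric.infDist u (Θ '' S)ᶜ} with hMid
  have hMidP : Mid ⊆ Θ '' S := by
    rintro u ⟨-, hu⟩
    by_contra h
    have h0 := Metric.infDist_zero_of_mem (show u ∈ (Θ '' S)ᶜ from h)
    linarith
  set Mid₀ : Set E4 := Mid ∩ {u : E4 | u 0 = 0} with hMid₀
  have hMid₀c : IsCompact Mid₀ := by
    refine Metric.isCompact_of_isClosed_isBounded ?_ ?_
    · refine (IsClosed.inter (isClosed_le E4.continuous_spatialNorm continuous_const)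
        (isClosed_le continuous_const (Metric.continuous_infDist_pt _))).inter ?_
      exact isClosed_eq ((EuclideanSpace.proj (𝕜 := ℝ) (0 : Fin 4)).continuous) continuous_const
    · refine (Metric.isBounded_closedBall (x := (0 : E4)) (r := R')).subset fun u hu ↦ ?_
      rw [mem_closedBall_zero_iff]
      have h := E4.norm_sq_eq_time_sq_add u
      rw [show u 0 = 0 from hu.2] at h
      nlinarith [hu.1.1, E4.spatialNorm_nonneg u, norm_nonneg u]
  have hinvC : ContinuousOn (chartInv Θ S) (Θ '' S) := fun u hu ↦
    (continuousAt_chartInv hSo hΘs hΘinj hΘiso hB₂ hu).continuousWithinAt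
  set K : Set E4 := chartInv Θ S '' Mid₀ with hK
  have hKc : IsCompact K := hMid₀c.image_of_continuousOn (hinvC.mono (inter_subset_left.trans hMidP))
  obtain ⟨R_M, hR_M⟩ : ∃ R_M : ℝ, ∀ x ∈ K, Kerr.radius a x ≤ R_M := by
    obtain ⟨B, hB⟩ := (hKc.image (Kerr.continuous_radius a)).bddAbove
    exact ⟨B, fun x hx ↦ hB (Set.mem_image_of_mem _ hx)⟩
  have hrdiff : ∀ x ∈ S, DifferentiableAt ℝ (Kerr.radius a) x := fun x hx ↦
    (Kerr.contDiffAt_radius (Kerr.radius_pos_of_mem_region hx) (n := 1)).differentiableAt one_ne_zero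
  have hClaimA : ∀ x ∈ S, Θ x ∈ Mid → Kerr.radius a x ≤ R_M := by
    intro x hx hmid
    have hu : Θ x ∈ Θ '' S := Set.mem_image_of_mem _ hx
    set s : ℝ := -(Θ x 0) with hs
    have hus : Θ x + s • E4.basisVector 0 ∈ Mid₀ := by
      refine ⟨⟨?_, ?_⟩, ?_⟩
      · rw [Summit.FinalStateConjecture.FinalStateConjecture.Theorems.SwallowTheDatum.UniversalWitnessFamily.spatialNorm_add_smul_basisVector]; exact hmid.1
      · rw [infDist_add_smul_basisVector hPcinv]; exact hmid.2
      · show (Θ x + s • E4.basisVector 0) 0 = 0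
        rw [GaussianBeam.apply_zero_add_smul_basisVector_zero, hs, add_neg_cancel]
    have h1 := hR_M _ (Set.mem_image_of_mem _ hus)
    rw [apply_chartInv_line_eq hSo hΘs hΘinj hΘiso hB₂ hYv' hPinv hrdiff hYr hu s,
      chartInv_apply hΘinj hx] at h1
    exact h1
  -- the far region `{r > R''}` maps into the far cylinder or into the collar of `∂P`
  set R'' : ℝ := max R_M (Kerr.rPlus M a) with hR''
  have hR''0 : 0 ≤ R'' := hrp.le.trans (le_max_right _ _)
  have hreg : (Kerr.region a R'' : Set E4) ⊆ S := Kerr.region_mono a (le_max_right _ _)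
  set Far : Set E4 := {u | R' < E4.spatialNorm u} with hFar
  set NF : Set E4 := (Θ '' S) ∩ {u | Metric.infDist u (Θ '' S)ᶜ < 1 / 2} with hNF
  have hFo : IsOpen Far := isOpen_lt continuous_const E4.continuous_spatialNorm
  have hPo : IsOpen (Θ '' S) :=
    (kerrCharted_isOpenEmbedding 𝓑 A M a (Kerr.rPlus M a) Θ le_rfl hΘs hΘinj hΘiso).2
  have hNFo : IsOpen NF := hPo.inter (isOpen_lt (Metric.continuous_infDist_pt _) continuous_const)
  have hdisj : Disjoint Far NF := by
    rw [Set.disjoint_left]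
    rintro u hu ⟨-, hu'⟩
    have h : (1 / 2 : ℝ) ≤ Metric.infDist u (Θ '' S)ᶜ := by
      refine (Metric.le_infDist ⟨v₀, hv₀'⟩).2 fun v hv ↦ ?_
      by_contra hlt
      push Not at hlt
      apply hv
      apply hfarP
      have h1 := E4.abs_spatialNorm_sub_le u v
      rw [← dist_eq_norm] at h1
      have h2 : R' < E4.spatialNorm u := hu
      linarith [(abs_le.1 h1).2]
    have h3 : Metric.infDist u (Θ '' S)ᶜ < 1 / 2 := hu'
    linarith
  have hsub : Θ '' (Kerr.region a R'' : Set E4) ⊆ Far ∪ NF := by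
    rintro _ ⟨x, hx, rfl⟩
    have hxS := hreg hx
    by_cases h1 : R' < E4.spatialNorm (Θ x)
    · exact Or.inl h1
    by_cases h2 : Metric.infDist (Θ x) (Θ '' S)ᶜ < 1 / 2
    · exact Or.inr ⟨Set.mem_image_of_mem _ hxS, h2⟩
    exfalso
    have h3 := hClaimA x hxS ⟨not_lt.1 h1, not_lt.1 h2⟩
    have h4 : max R'' 0 < Kerr.radius a x := Kerr.mem_region.1 hx
    rw [max_eq_left hR''0] at h4
    linarith [le_max_left R_M (Kerr.rPlus M a)]
  have hconn : IsPreconnected (Θ '' (Kerr.region a R'' : Set E4)) :=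
    ((Kerr.Facts.isConnected_region a R'').image Θ (hΘs.continuousOn.mono hreg)).isPreconnected
  rcases hconn.subset_or_subset hFo hNFo hdisj hsub with hgood | hbad
  · -- the far region goes to the far cylinder: conclude
    refine ⟨R'' + 1, fun x hxR ↦ ?_⟩
    have hxreg : x.1 ∈ (Kerr.region a R'' : Set E4) := by
      rw [SetLike.mem_coe, Kerr.mem_region, max_eq_left hR''0]; linarith
    have hfar : R' < E4.spatialNorm (Θ x.1) := hgood (Set.mem_image_of_mem _ hxreg)
    have hΘx : Θ x.1 = chartPreimage A (Ψ x) := by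
      rw [hΘ_def]
      show chartPreimage A (kerrExtend Ψ x.1) = _
      rw [kerrExtend_apply]
    rw [← hΘx]
    linarith [hradA (Θ x.1)]
  · -- the far region goes to the collar of `∂P`: contradiction
    exfalso
    -- the time-normalised preimages of the far leaf points
    set sSeq : ℕ → ℝ := fun n ↦ -(chartInv Θ S (uSeq n) 0) / α with hsSeq
    set xSeq : ℕ → E4 := fun n ↦ chartInv Θ S (uSeq n + sSeq n • E4.basisVector 0) with hxSeq
    have hxS : ∀ n, xSeq n ∈ S := fun n ↦ (chartInv_spec (hPinv _ (huP n) _)).1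
    have hΘx : ∀ n, Θ (xSeq n) = uSeq n + sSeq n • E4.basisVector 0 := fun n ↦
      (chartInv_spec (hPinv _ (huP n) _)).2
    have hx0 : ∀ n, xSeq n 0 = 0 := by
      intro n
      rw [hxSeq]
      dsimp only
      rw [chartInv_line_apply_zero hSo hΘs hΘinj hΘiso hB₂ hYv' hPinv (fun x _ ↦ hα x) (huP n), hsSeq]
      field_simp
      ring
    have hfarx : ∀ n, E4.spatialNorm (Θ (xSeq n)) = R' + 1 + n := fun n ↦ by
      rw [hΘx, Summit.FinalStateConjecture.FinalStateConjecture.Theorems.SwallowTheDatum.UniversalWitnessFamily.spatialNorm_add_smul_basisVector, huN]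
    have hrad : ∀ n, Kerr.radius a (xSeq n) ≤ R'' := by
      intro n
      by_contra h
      push Not at h
      have hxreg : xSeq n ∈ (Kerr.region a R'' : Set E4) := by
        rw [SetLike.mem_coe, Kerr.mem_region, max_eq_left hR''0]; exact h
      have h1 : Θ (xSeq n) ∈ NF := hbad (Set.mem_image_of_mem _ hxreg)
      have h2 : Θ (xSeq n) ∈ Far := by
        show R' < E4.spatialNorm (Θ (xSeq n))
        rw [hfarx]; linarith [(Nat.cast_nonneg n : (0 : ℝ) ≤ n)]
      exact Set.disjoint_left.1 hdisj h2 h1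
    have hradpos : ∀ n, Kerr.rPlus M a < Kerr.radius a (xSeq n) := fun n ↦
      Kerr.lt_radius_of_mem_region (hxS n)
    set B : ℝ := √(R'' ^ 2 + a ^ 2) with hB
    have hbound : ∀ n, ‖xSeq n‖ ≤ B := by
      intro n
      have h1 := E4.norm_sq_eq_time_sq_add (xSeq n)
      rw [hx0 n] at h1
      have h2 := Kerr.spatialNorm_sq_le (Kerr.radius_pos_of_mem_region (hxS n))
      have h3 : Kerr.radius a (xSeq n) ^ 2 ≤ R'' ^ 2 :=
        pow_le_pow_left₀ (Kerr.radius_nonneg a _) (hrad n) 2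
      have h4 : ‖xSeq n‖ ^ 2 ≤ R'' ^ 2 + a ^ 2 := by nlinarith
      calc ‖xSeq n‖ = √(‖xSeq n‖ ^ 2) := (Real.sqrt_sq (norm_nonneg _)).symm
        _ ≤ √(R'' ^ 2 + a ^ 2) := Real.sqrt_le_sqrt h4
    obtain ⟨xstar, -, φ, hφ, hlim⟩ :=
      (isCompact_closedBall (0 : E4) B).tendsto_subseq (fun n ↦ mem_closedBall_zero_iff.2 (hbound n))
    -- the limit point is not in the exterior
    have hnotS : xstar ∉ S := by
      intro h
      have hΘc : ContinuousAt Θ xstar := hΘs.continuousOn.continuousAt (hSo.mem_nhds h)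
      have h1 : Tendsto (fun n ↦ E4.spatialNorm (Θ (xSeq (φ n)))) atTop (𝓝 (E4.spatialNorm (Θ xstar))) :=
        ((E4.continuous_spatialNorm.continuousAt.comp hΘc).tendsto).comp hlim
      have h2 : Tendsto (fun n ↦ E4.spatialNorm (Θ (xSeq (φ n)))) atTop atTop := by
        have h3 : (fun n ↦ E4.spatialNorm (Θ (xSeq (φ n)))) = fun n ↦ R' + 1 + ((φ n : ℕ) : ℝ) :=
          funext fun n ↦ hfarx (φ n)
        rw [h3]
        exact tendsto_atTop_add_const_left _ _
          (tendsto_natCast_atTop_atTop.comp hφ.tendsto_atTop)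
      exact not_tendsto_atTop_of_tendsto_nhds h1 h2
    -- hence it lies on the horizon `{r = r₊}`
    have hr1 : Kerr.radius a xstar ≤ Kerr.rPlus M a := by
      have h : ¬ (max (Kerr.rPlus M a) 0 < Kerr.radius a xstar) := fun h' ↦
        hnotS (show xstar ∈ (Kerr.exterior M a : Set E4) from Kerr.mem_exterior.2 h')
      rw [max_eq_left hrp.le] at h
      exact not_lt.1 h
    have hr2 : Kerr.rPlus M a ≤ Kerr.radius a xstar :=
      ge_of_tendsto (((Kerr.continuous_radius a).continuousAt.tendsto).comp hlim)
        (Filter.Eventually.of_forall fun n ↦ (hradpos (φ n)).le)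
    have hr : Kerr.radius a xstar = Kerr.rPlus M a := le_antisymm hr1 hr2
    -- `Q` is continuous there, `≤ −1/2` along the sequence, `≥ 0` at the limit
    have hQc : ContinuousAt Q xstar := by
      have hb : ContinuousAt (Kerr.bilin M a) xstar :=
        (Kerr.contDiffAt_bilin M a (by rw [hr]; exact hrp) (n := 0)).continuousAt
      exact (hb.clm_apply hYc.continuousAt).clm_apply hYc.continuousAt
    have hQlim : Tendsto (fun n ↦ Q (xSeq (φ n))) atTop (𝓝 (Q xstar)) := hQc.tendsto.comp hlim
    have hQle : Q xstar ≤ -(1 / 2) :=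
      le_of_tendsto hQlim (Filter.Eventually.of_forall fun n ↦ hQfar _ (hxS (φ n))
        (by rw [hfarx]; linarith [(Nat.cast_nonneg (φ n) : (0 : ℝ) ≤ (φ n : ℕ))]))
    have hQge : 0 ≤ Q xstar := hYhor xstar hr
    linarith

end EndMatching

end Summit.FinalStateConjecture.FinalStateConjecture.Theorems.SymplecticDualOfTheBomb

end
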